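import Summits.ResolutionOfSingularities.ResolutionOfSingularities.Theses.ShadowGame
import Summits.ResolutionOfSingularities.ResolutionOfSingularities.Theses.FrobeniusClosing
import Literature.AlgebraicGeometry.Resolution.ResolutionLU

/-!
# Negative lemmas for crux `TorsorToLurelPerfect` (stmt-ResolutionOfSingularities-16162):
# the hypothesis is NECESSARY, and the crux has no failure mode independent of the summit

Crux (shared ×5; primary decl `Theses.ShadowGame.TorsorToLurelPerfect`, same term as the
FrobeniusClosing / WildCones / FoliationDescent / JacobianBudget copies):
`∀ p prime, H p → C p`, `H p` = local uniformization of `α_p`-torsors `t ^ p = a` over bases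
regular at the centre over PERFECT ground fields, `C p` = relative local uniformization over
PERFECT ground fields (cdisprove cycle 1, §1 of `Cruxes/TorsorToLurelPerfect/Disproof.lean`).

* `torsorLU_of_lurel_perfect` — **`C p → H p`**: torsor LU is the instance `R := k[A₀, t]` of
  relative LU (`t ∈ O` since `t ^ p ∈ A₀ ⊆ O` and valuation rings are integrally closed; `K/k` is
  finitely generated since `K = Frac k[A₀, t]`). The base's regularity is not used. Hence the crux
  is, prime by prime, the EQUIVALENCE `H p ↔ C p` (`torsorToLurelPerfect_iff_forall_iff`).
* `not_torsorToLurelPerfect_iff` — a refutation of the crux is EXACTLY a prime `p` with `H p` and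
  `¬ C p`; `exists_not_resolutionInChar_of_not_torsorToLurelPerfect` — hence a counterexample to
  resolution in characteristic `p` (tree `lurel_of_resolutionInChar`): the crux has no failure
  mode independent of the summit, and no finite / degenerate / junk-model refutation exists.
-/

set_option linter.dupNamespace false

open IsLocalRing
open Literature.AlgebraicGeometry.Resolution

namespace Summit.ResolutionOfSingularities.ResolutionOfSingularities.Theorems.TorsorToLurelPerfect.Negative

open Summit.ResolutionOfSingularities.ResolutionOfSingularities

/-- `t ^ n ∈ O`, `n ≠ 0` ⇒ `t ∈ O` for a valuation ring `O` of `K` (elementary form of integral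
closedness: `t = t ^ n · (t⁻¹) ^ (n-1)`). [folklore] -/
theorem mem_valuationSubring_of_pow_mem {K : Type*} [Field K] (O : ValuationSubring K) {t : K}
    {n : ℕ} (hn : n ≠ 0) (ht : t ^ n ∈ O) : t ∈ O := by
  rcases O.mem_or_inv_mem t with h | h
  · exact h
  · by_cases ht0 : t = 0
    · rw [ht0]; exact O.zero_mem
    · have key : t = t ^ n * (t⁻¹) ^ (n - 1) := by
        rw [inv_pow, ← pow_sub₀ t ht0 (Nat.sub_le n 1),
          Nat.sub_sub_self (Nat.one_le_iff_ne_zero.mpr hn), pow_one]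
      rw [key]
      exact mul_mem ht (pow_mem h _)

/-- **`C p → H p`: the hypothesis of `TorsorToLurelPerfect` is NECESSARY** — over perfect ground
fields of characteristic `p`, relative local uniformization (the crux's conclusion, hypothesis
`hC`) implies local uniformization of `α_p`-torsors over bases regular at the centre (the crux's
antecedent = route item `TorsorLUPerfect` at `p`), as the instance `R := k[A₀, t]`. The regularity
of the base `A₀` is not used. [folklore] -/
theorem torsorLU_of_lurel_perfect {p : ℕ} (hp : p.Prime)
    (hC : ∀ (k K : Type) [Field k] [CharP k p] [PerfectField k] [Field K] [Algebra k K],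
      (⊤ : IntermediateField k K).FG → ∀ O : ValuationSubring K, (∀ c : k, algebraMap k K c ∈ O) →
      ∀ R : Subalgebra k K, R.FG → R.toSubring ≤ O.toSubring →
      ∃ (A : Subalgebra k K) (h : A.toSubring ≤ O.toSubring), R ≤ A ∧ A.FG ∧ IsFractionRing A K ∧
        IsRegularLocalRing (Localization.AtPrime
          (Ideal.comap (Subring.inclusion h) (maximalIdeal O)))) :
    ∀ (k K : Type) [Field k] [CharP k p] [PerfectField k] [Field K] [Algebra k K]
      (O : ValuationSubring K) (A₀ : Subalgebra k K) (h₀ : A₀.toSubring ≤ O.toSubring) (t : K),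
      A₀.FG → t ^ p ∈ A₀ → IsFractionRing (Algebra.adjoin k (insert t (A₀ : Set K))) K →
      IsRegularLocalRing (Localization.AtPrime
        (Ideal.comap (Subring.inclusion h₀) (maximalIdeal O))) →
      ∃ (A : Subalgebra k K) (h : A.toSubring ≤ O.toSubring), A₀ ≤ A ∧ t ∈ A ∧ A.FG ∧
        IsFractionRing A K ∧
        IsRegularLocalRing (Localization.AtPrime
          (Ideal.comap (Subring.inclusion h) (maximalIdeal O))) := by
  intro k K _ _ _ _ _ O A₀ h₀ t hfg htp hfrac _
  classical
  obtain ⟨s₀, hs₀⟩ := hfg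
  have hO : ∀ c : k, algebraMap k K c ∈ O := fun c => h₀ (A₀.algebraMap_mem c)
  have htO : t ∈ O := mem_valuationSubring_of_pow_mem O hp.ne_zero (h₀ htp)
  have hRs : Algebra.adjoin k (insert t (A₀ : Set K)) = Algebra.adjoin k (insert t (s₀ : Set K)) := by
    rw [← hs₀, Algebra.adjoin_insert_adjoin]
  have hRfg : (Algebra.adjoin k (insert t (A₀ : Set K))).FG :=
    ⟨insert t s₀, by rw [Finset.coe_insert, hRs]⟩
  have hKfg : (⊤ : IntermediateField k K).FG := by
    refine ⟨insert t s₀, top_le_iff.mp fun z _ => ?_⟩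
    obtain ⟨a, b, -, rfl⟩ :=
      IsFractionRing.div_surjective (A := Algebra.adjoin k (insert t (A₀ : Set K))) z
    have hle : Algebra.adjoin k (insert t (A₀ : Set K)) ≤
        (IntermediateField.adjoin k ((insert t s₀ : Finset K) : Set K)).toSubalgebra := by
      rw [hRs, Finset.coe_insert]
      exact IntermediateField.algebra_adjoin_le_adjoin k _
    exact div_mem (hle a.2) (hle b.2)
  let Oalg : Subalgebra k K := { O.toSubring with algebraMap_mem' := hO }
  have hRO : (Algebra.adjoin k (insert t (A₀ : Set K))).toSubring ≤ O.toSubring := by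
    change Algebra.adjoin k (insert t (A₀ : Set K)) ≤ Oalg
    exact Algebra.adjoin_le (Set.insert_subset htO fun x hx => h₀ hx)
  obtain ⟨A, h, hRA, hAfg, hAfr, hAreg⟩ := hC k K hKfg O hO _ hRfg hRO
  exact ⟨A, h, fun x hx => hRA (Algebra.subset_adjoin (Set.mem_insert_of_mem t hx)),
    hRA (Algebra.subset_adjoin (Set.mem_insert t _)), hAfg, hAfr, hAreg⟩

/-- **The crux is, prime by prime, an EQUIVALENCE** between torsor LU and relative LU over
perfect ground fields: `TorsorToLurelPerfect ↔ ∀ p prime, (H p ↔ C p)`. [folklore] -/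
theorem torsorToLurelPerfect_iff_forall_iff :
    Theses.ShadowGame.TorsorToLurelPerfect ↔
      ∀ p : ℕ, p.Prime →
        ((∀ (k K : Type) [Field k] [CharP k p] [PerfectField k] [Field K] [Algebra k K]
            (O : ValuationSubring K) (A₀ : Subalgebra k K) (h₀ : A₀.toSubring ≤ O.toSubring) (t : K),
            A₀.FG → t ^ p ∈ A₀ → IsFractionRing (Algebra.adjoin k (insert t (A₀ : Set K))) K →
            IsRegularLocalRing (Localization.AtPrime
              (Ideal.comap (Subring.inclusion h₀) (maximalIdeal O))) →
            ∃ (A : Subalgebra k K) (h : A.toSubring ≤ O.toSubring), A₀ ≤ A ∧ t ∈ A ∧ A.FG ∧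
              IsFractionRing A K ∧
              IsRegularLocalRing (Localization.AtPrime
                (Ideal.comap (Subring.inclusion h) (maximalIdeal O)))) ↔
          ∀ (k K : Type) [Field k] [CharP k p] [PerfectField k] [Field K] [Algebra k K],
            (⊤ : IntermediateField k K).FG → ∀ O : ValuationSubring K,
            (∀ c : k, algebraMap k K c ∈ O) → ∀ R : Subalgebra k K, R.FG →
            R.toSubring ≤ O.toSubring →
            ∃ (A : Subalgebra k K) (h : A.toSubring ≤ O.toSubring), R ≤ A ∧ A.FG ∧
              IsFractionRing A K ∧ IsRegularLocalRing (Localization.AtPrime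
                (Ideal.comap (Subring.inclusion h) (maximalIdeal O)))) :=
  ⟨fun h p hp => ⟨h p hp, torsorLU_of_lurel_perfect hp⟩, fun h p hp => (h p hp).mp⟩

/-- **Why the crux resists refutation**: `¬ TorsorToLurelPerfect` is exactly a prime `p` at
which torsor LU over perfect fields HOLDS and relative LU over some perfect field FAILS.
[folklore] -/
theorem not_torsorToLurelPerfect_iff :
    ¬ Theses.ShadowGame.TorsorToLurelPerfect ↔
      ∃ p : ℕ, p.Prime ∧
        (∀ (k K : Type) [Field k] [CharP k p] [PerfectField k] [Field K] [Algebra k K]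
            (O : ValuationSubring K) (A₀ : Subalgebra k K) (h₀ : A₀.toSubring ≤ O.toSubring) (t : K),
            A₀.FG → t ^ p ∈ A₀ → IsFractionRing (Algebra.adjoin k (insert t (A₀ : Set K))) K →
            IsRegularLocalRing (Localization.AtPrime
              (Ideal.comap (Subring.inclusion h₀) (maximalIdeal O))) →
            ∃ (A : Subalgebra k K) (h : A.toSubring ≤ O.toSubring), A₀ ≤ A ∧ t ∈ A ∧ A.FG ∧
              IsFractionRing A K ∧
              IsRegularLocalRing (Localization.AtPrime
                (Ideal.comap (Subring.inclusion h) (maximalIdeal O)))) ∧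
        ¬ ∀ (k K : Type) [Field k] [CharP k p] [PerfectField k] [Field K] [Algebra k K],
            (⊤ : IntermediateField k K).FG → ∀ O : ValuationSubring K,
            (∀ c : k, algebraMap k K c ∈ O) → ∀ R : Subalgebra k K, R.FG →
            R.toSubring ≤ O.toSubring →
            ∃ (A : Subalgebra k K) (h : A.toSubring ≤ O.toSubring), R ≤ A ∧ A.FG ∧
              IsFractionRing A K ∧ IsRegularLocalRing (Localization.AtPrime
                (Ideal.comap (Subring.inclusion h) (maximalIdeal O))) := by
  constructor
  · intro h
    by_contra h'
    exact h fun p hp hH => by_contra fun hC => h' ⟨p, hp, hH, hC⟩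
  · rintro ⟨p, hp, hH, hC⟩ h
    exact hC (h p hp hH)

/-- … hence **an unconditional `¬ TorsorToLurelPerfect` is a counterexample to resolution of
singularities in some prime characteristic** (the crux's conclusion is summit-implied, tree
`lurel_of_resolutionInChar`): the crux has no failure mode independent of the summit. [folklore] -/
theorem exists_not_resolutionInChar_of_not_torsorToLurelPerfect
    (h : ¬ Theses.ShadowGame.TorsorToLurelPerfect) : ∃ p : ℕ, p.Prime ∧ ¬ ResolutionInChar.{0} p := by
  obtain ⟨p, hp, -, hC⟩ := not_torsorToLurelPerfect_iff.mp h
  exact ⟨p, hp, fun hR => hC fun k K _ _ _ _ _ hKfg O hO R hRfg hRO =>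
    lurel_of_resolutionInChar p hp hR k K hKfg O hO R hRfg hRO⟩

/-- The same for the payload route's copy (FrobeniusClosing; the two decls are one term). [folklore] -/
theorem exists_not_resolutionInChar_of_not_torsorToLurelPerfect_frobeniusClosing
    (h : ¬ Theses.FrobeniusClosing.TorsorToLurelPerfect) :
    ∃ p : ℕ, p.Prime ∧ ¬ ResolutionInChar.{0} p :=
  exists_not_resolutionInChar_of_not_torsorToLurelPerfect h

end Summit.ResolutionOfSingularities.ResolutionOfSingularities.Theorems.TorsorToLurelPerfect.Negative
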